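import Summits.QuantumFields.YangMills.Theorems.F4SubCurvatureDoorShortRootRigidityTrigonalDefs
import Summits.QuantumFields.YangMills.Theorems.F4SubCurvatureDoorShortRootRigiditySchwarzReflection
import Mathlib
import HarnessLib

/-!
# Trigonal Injectivity — STUB L1 `stub_reflection` (algebraic Schwarz reflection identity), BY NAME AND SIGNATURE

Sub-skeleton `Cruxes/ShortRootRigidity/Lines/trigonal_injectivity.lean` (planner ym-idea-3 g21, commit b8c4174ce46e), stub L1 (:130),
crux ⟨stmt-QuantumFields-23035⟩ `F4SubCurvatureDoor.ShortRootRigidity`, stub `:146 stub_oddModeRigidity` (algebraic half).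

`stub_reflection (Y : P3) (hh : lap Y = 0) (hp : lap (bind₁ (linSubst Pm) Y) = 0) : Y + bind₁ (linSubst Rf) Y = C 2 * bind₁ (linSubst Pm) Y`
over the shared vocabulary of ✓`…ShortRootRigidityTrigonalDefs` (verbatim copy of the sub-skeleton's defs), i.e. `Y + Y∘σ = 2·Y∘proj` for the
reflection `σ = 1 − 2J/3` and the projection `proj = 1 − J/3` of the plane `x+y+z = 0`.

PROOF (the owner's route, 14:54:53Z): `u := Y − Y∘proj` is harmonic (both terms are, by `hh`, `hp`) and vanishes on the plane (`proj = id`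
there), so by the polynomial SCHWARZ REFLECTION ✓`eval_reflect_eq_neg` (w3 g38, ✓p726989) `u(σx) = −u(x)`; since `proj∘σ = proj` this reads
`Y(σx) − Y(proj x) = −Y(x) + Y(proj x)`, and `MvPolynomial.funext` turns the point identity into the polynomial identity.  No homogeneity and
no symmetry hypothesis is needed.  Also recorded: `reflectionIdentity_holds : ReflectionIdentity` (the Prop of the composition
✓`trigonalInjectivityQ_of`).

Mathlib + tree only; no `sorry`.  HONEST LABEL: one of four stubs of a sub-skeleton of the OPEN stub `:146`; `OddModeRigidity`, ⟨23035⟩,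
⟨23125⟩, R2d and the Yang–Mills mass gap remain OPEN; no summit is proved by a line.  Seat `ym-line-frs-p2` g16 (cell ym-idea-3, free hands).
-/

noncomputable section

open MvPolynomial
open scoped BigOperators
open Literature.Algebra.Polynomial

namespace Summit.QuantumFields.YangMills.Theorems.F4SubCurvatureDoorTrigonalLine

open Summit.QuantumFields.YangMills.Theorems.F4SubCurvatureDoorSchwarzReflection (laplacian3 eval_reflect_eq_neg)

/-! ## Matrix calculus for `σ` and `proj` -/

/-- `σ x = x − (2/3)(x₀+x₁+x₂)(1,1,1)` coordinatewise. -/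
theorem Rf_mulVec (x : Fin 3 → ℝ) : Rf.mulVec x = fun i => x i - 2 / 3 * (x 0 + x 1 + x 2) := by
  ext i; fin_cases i <;> simp [Rf, J3, Matrix.mulVec, dotProduct, Fin.sum_univ_three, Matrix.one_apply, Matrix.sub_apply] <;> ring

/-- `proj x = x − (1/3)(x₀+x₁+x₂)(1,1,1)` coordinatewise. -/
theorem Pm_mulVec (x : Fin 3 → ℝ) : Pm.mulVec x = fun i => x i - 1 / 3 * (x 0 + x 1 + x 2) := by
  ext i; fin_cases i <;> simp [Pm, J3, Matrix.mulVec, dotProduct, Fin.sum_univ_three, Matrix.one_apply, Matrix.sub_apply] <;> ring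

/-- `proj ∘ σ = proj`. -/
theorem Pm_mulVec_Rf_mulVec (x : Fin 3 → ℝ) : Pm.mulVec (Rf.mulVec x) = Pm.mulVec x := by
  rw [Rf_mulVec, Pm_mulVec, Pm_mulVec]
  funext i
  ring

/-- The image of `proj` lies in the plane: the coordinates of `proj x` sum to `0`. -/
theorem Pm_mulVec_sum (x : Fin 3 → ℝ) : Pm.mulVec x 0 + Pm.mulVec x 1 + Pm.mulVec x 2 = 0 := by
  rw [Pm_mulVec]
  ring

/-! ## The Laplacian `lap` -/

/-- `lap` is the tree's `laplacian3` (same formula). -/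
theorem lap_eq_laplacian3 (Y : P3) : lap Y = laplacian3 Y := rfl

/-- `lap` is additive: `lap (Y − Z) = lap Y − lap Z`. -/
theorem lap_sub (Y Z : P3) : lap (Y - Z) = lap Y - lap Z := by
  simp only [lap, map_sub, Finset.sum_sub_distrib]

/-! ## Stub L1 -/

/-- STUB L1 (M−) — ALGEBRAIC SCHWARZ REFLECTION.  `v := Y + Y∘σ − 2·Y∘proj` is harmonic (`σ` orthogonal:
`laplacian_bind₁_linSubst`; `Y∘proj` harmonic by hypothesis), `σ`-even, and vanishes on the plane (`σ = proj = id` there);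
even + vanishing ⇒ `(x+y+z)² ∣ v`; a harmonic polynomial divisible by the square of a linear form is `0`
(`v = λ^k w`, `k ≥ 2` maximal ⇒ `0 = Δv = λ^{k−2}[k(k−1)|n|² w + λ(…)]` ⇒ `λ ∣ w`).  [TrigonalInjectivity.md §1-bis (2′)]
PROVED here via the polynomial Schwarz reflection ✓`eval_reflect_eq_neg` applied to `u := Y − Y∘proj`. -/
theorem stub_reflection (Y : P3) (hh : lap Y = 0) (hp : lap (bind₁ (linSubst Pm) Y) = 0) :
    Y + bind₁ (linSubst Rf) Y = C (2 : ℝ) * bind₁ (linSubst Pm) Y := by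
  set u : P3 := Y - bind₁ (linSubst Pm) Y with hu
  have hharm : laplacian3 u = 0 := by
    rw [← lap_eq_laplacian3, hu, lap_sub, hh, hp, sub_zero]
  have hvan : ∀ x : Fin 3 → ℝ, x 0 + x 1 + x 2 = 0 → eval x u = 0 := by
    intro x hx
    rw [hu, map_sub, eval_bind₁_linSubst, Pm_mulVec_of_plane x hx, sub_self]
  apply MvPolynomial.funext
  intro x
  have key := eval_reflect_eq_neg u hharm hvan x
  rw [← Rf_mulVec x, hu, map_sub, map_sub, eval_bind₁_linSubst, eval_bind₁_linSubst, Pm_mulVec_Rf_mulVec] at key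
  rw [map_add, map_mul, eval_C, eval_bind₁_linSubst, eval_bind₁_linSubst]
  linarith

/-- **L1 as the Prop of the composition**: `ReflectionIdentity` holds. -/
theorem reflectionIdentity_holds : ReflectionIdentity :=
  fun Y hh hp => stub_reflection Y hh hp

end Summit.QuantumFields.YangMills.Theorems.F4SubCurvatureDoorTrigonalLine

end
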